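import Mathlib
import Literature.MathematicalPhysics.QuantumFieldTheory.IsingGaugeHighTemperatureExpansion
import Literature.MathematicalPhysics.QuantumFieldTheory.PlaquetteRandomClusterEulerPoincare
import HarnessLib

/-!
# The random-cluster model with boundary `γ` and its couplings with the high-temperature and the
# random-current models of Ising (`ℤ₂`) lattice gauge theory (Forsström–Viklund 2025,
# Theorem 1.3 (c), (d); Proposition 6.7, upper half) — PROVED on the finite torus

Companion of `IsingGaugeHighTemperatureExpansion` (the high-temperature model `P^γ_β`, the
random-current model `𝐏^γ_β`, its percolation law `𝐏̂^γ_β`, Theorem 1.3 (a), (b), Prop. 6.7 lower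
half) and of the plaquette random-cluster files (`PlaquetteRandomCluster`: `weight p q ω =
p^{|ω|}(1-p)^{|ωᶜ|} q^{b₁(P(ω))}`; `PlaquetteRandomClusterEulerPoincare`: `twoCycles`, `bettiTwo`,
Prop. 15 `weight_mul_pow_card`; `PottsGaugeEdwardsSokal.IsNullHomologousIn` = the event `V_γ`).

* M. P. Forsström, F. Viklund, *Current expansion and couplings for Ising lattice gauge theory*,
  arXiv:2502.19942 [ForsstromViklund2025currents] (arXiv TeX source of v2), §1.3: the *random
  cluster model with boundary `γ`*, `φ^γ_{B_N,p}(P) ∝ 𝟙[P ∈ 𝒫_γ] 2^{𝐛₁(P,ℤ₂)} p^{|P|}(1-p)^{|Pᶜ|}`,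
  `𝒫_γ = {P ⊆ C₂(B_N)⁺ : ∃ P' ⊆ P, ∂P' = γ}`; **Theorem 1.3 (c)**: for `β > 0`, `η ∼ P^γ_{B_N,β}`,
  `X₂ ∼ Ψ_{tanh 2β}`, `X₃ ∼ Ψ_{1-e^{-2β}}` independent, `ω := max(η, X₂) =ᵈ max(n̂, X₃)` and
  `supp ω ∼ φ^γ_{B_N,β}` (:= `φ^γ_{B_N,1-e^{-4β}}`); **(d)**: if `P ∼ φ^γ` and `P' ∼ unif{P' ⊆ P :
  ∂P' = γ}` then `η' := 𝟙_{P'} ∼ P^γ_{B_N,β}`; proof §5 (the joint law of `(η, max(η,X₂))` equals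
  that of `(unif S_γ(P'), P')`, using `|S_γ(P')| = |S_0(P')|` and
  `Σ_σ 𝟙(dσ(P') ≡ 0) = 2^{𝐛₁(P')} = 2^{|C₁⁺| - |P'|} |S_0(P')|`); §6 **Proposition 6.7** (upper half):
  `𝐏̂⁰_{B_N,β} ≤ Ψ_{1-e^{-4β}}` "by combining Proposition 6.6 and Theorem 1.3".

## Scope (read this first)

Gauge group `ℤ₂` only; finite torus `𝕋^d_L`. Nothing here bears on the Yang–Mills mass gap or on
`BalabanLadder.IR`; in the `ym` ladder only the conditional finite-`𝕋⁴` rung `BalabanLadder.UV` is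
closed by any route. Typed for the `ym-ir` census row A9 ("Thm 1.3 (couplings) not typed").

## What is typed (transcriber's form, flagged)

* Couplings are push-forward / joint-law identities of the finite laws, as in the companion file.
  `𝒫_γ` is `{P : IsNullHomologousIn P γ}` (`ℤ₂` coefficients: "`∃ P' ⊆ P` with `∂P' = γ`");
  `S_γ(P) = {η : supp η ⊆ P, ∂η = γ}` is `surfaces γ P`; `2^{𝐛₁(P,ℤ₂)} p^{|P|}(1-p)^{|Pᶜ|}` is the
  tree's `PlaquetteRC.weight (ZMod 2) p 2 P` (cohomological `b₁`, reading R3 of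
  `PlaquetteRandomCluster`; for `γ = 0`, `φ⁰_p = PlaquetteRC.prob (ZMod 2) p 2`, `phiProb_zero`).
* The printed proof of Theorem 1.3 writes `p₃ := 1 - e^{-2β}` both for the parameter of `X₃` (correct)
  and, in the last display, for the random-cluster parameter, where `1 - e^{-4β}` is meant
  (`(tanh 2β)^{|η'|}(1 - tanh 2β)^{|C ∖ η'|} ∝ ((1-e^{-4β})/2)^{|η'|} (e^{-4β})^{|C ∖ η'|}`, consistent with
  `𝔼[W_γ] = φ⁰_{1-e^{-4β}}(𝒫_γ)`); we type `φ^γ_β := φ^γ_{1-e^{-4β}}`.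
* The topological input "`2^{𝐛₁(P')} = 2^{|C₁⁺|-|P'|} |S_0(P')|`" is the tree's Euler–Poincaré
  relation `weight_mul_pow_card` with `|S_0(P)| = |Z₂(P(P); 𝔽₂)| = 2^{b₂}` (`finrank_twoCycles`).
* `β > 0` and `γ` a `ℤ₂`-boundary (`∃ c, bd₂ c = γ`; automatic for loops in `B_N`) as printed.

## Contents (everything PROVED; no named fact)

* `phiWeight`/`phiSum`/`phiProb` (`φ^γ_p`), `phiProb_zero`; `surfaces γ P` (`S_γ(P)`),
  `card_surfaces_eq` (`|S_γ(P)| = 𝟙[P ∈ 𝒫_γ] |Z₂(P; 𝔽₂)|`), `natCard_twoCycles` (`= 2^{b₂(P)}`),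
  `phiWeight_eq` (`φ^γ`-weights through `|S_γ(P)| (sinh 2β)^{|P|} e^{-2β|Pᶜ|}`);
* **Theorem 1.3 (c), first form** `sum_htProb_bernoulli_eq_phiProb`
  (`(P^γ_β ⊗ Ψ_{tanh 2β})(supp η ∪ X = P) = φ^γ_β(P)`), **(d)** `htProb_mul_bernoulli_eq_phiProb_mul`
  (the joint law of `(η, supp η ∪ X₂)` is `φ^γ_β(P) · unif_{S_γ(P)}(η)`), and `htSum_eq_phiSum`;
* **Theorem 1.3 (c), second form** `hasSum_curProb_bernoulli_union`
  (`(𝐏^γ_β ⊗ Ψ_{1-e^{-2β}})(n̂ ∪ X = P) = φ^γ_β(P)`);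
* **Proposition 6.7, upper half** `percProb_zero_le_rc` (`𝐏̂⁰_β(E) ≤ φ⁰_β(E)`) and
  `percProb_zero_le_bernoulli` (`𝐏̂⁰_β(E) ≤ Ψ_{1-e^{-4β}}(E)` for increasing `E`, via Prop. 6.6 =
  `PlaquetteRC.eventProb_sandwich`);
* the Remark after Theorem 1.3 / **Proposition 6.6, lower half, for every boundary `γ`**:
  `bernoulli_le_sum_phiProb` (`Ψ_{tanh 2β}(E) ≤ φ^γ_β(E)`), `bernoulli_le_rc_zero`.
-/

open Finset Module

namespace Literature.MathematicalPhysics.QuantumFieldTheory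

namespace IsingGaugeCurrents

open LatticeForm PlaquetteRC

variable {d L : ℕ} [NeZero L]

/-! ### The random-cluster model with boundary `γ` -/

open Classical in
/-- The weight `𝟙[P ∈ 𝒫_γ] 2^{𝐛₁(P;ℤ₂)} p^{|P|} (1-p)^{|Pᶜ|}` of the random-cluster model with boundary
`γ` (`𝒫_γ = {P : γ = ∂P' for some P' ⊆ P}` = `IsNullHomologousIn P γ`).
[cite: ForsstromViklund2025currents, §1.3 (φ^γ_{B_N,p}, 𝒫_γ)] -/
noncomputable def phiWeight (p : ℝ) (γ : Site d L → Fin d → ZMod 2) (P : Finset (Plaquette d L)) : ℝ :=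
  if IsNullHomologousIn P γ then weight (ZMod 2) p 2 P else 0

/-- The normalising sum `Σ_{P' ∈ 𝒫_γ} 2^{𝐛₁(P')} p^{|P'|}(1-p)^{|P'ᶜ|}`. [cite: ForsstromViklund2025currents, §1.3 (φ^γ_{B_N,p})] -/
noncomputable def phiSum (p : ℝ) (γ : Site d L → Fin d → ZMod 2) : ℝ :=
  ∑ P : Finset (Plaquette d L), phiWeight p γ P

/-- The random-cluster model with boundary `γ`, `φ^γ_p(P)`. [cite: ForsstromViklund2025currents, §1.3 (φ^γ_{B_N,p})] -/
noncomputable def phiProb (p : ℝ) (γ : Site d L → Fin d → ZMod 2) (P : Finset (Plaquette d L)) : ℝ :=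
  phiWeight p γ P / phiSum p γ

/-- `∂0 = 0`. [cite: DuncanSchweinhart2025, §2.1 (∂)] -/
theorem bd₂_zero : bd₂ (0 : Plaquette d L → ZMod 2) = 0 := by
  funext x k
  simp [bd₂]

/-- `0 ∈ 𝒫_0(P)` for every `P`: the empty loop bounds the empty surface. [cite: ForsstromViklund2025currents, §1.3 ("𝒫_0 = C₂(B_N)⁺")] -/
theorem isNullHomologousIn_zero (P : Finset (Plaquette d L)) :
    IsNullHomologousIn P (0 : Site d L → Fin d → ZMod 2) :=
  ⟨0, fun _ _ => rfl, bd₂_zero⟩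

/-- **`φ⁰_p` is the plaquette random-cluster measure with `q = 2`** ("since `𝒫_0 = C₂(B_N)⁺`").
[cite: ForsstromViklund2025currents, §1.3 (φ⁰_{B_N,p})] -/
theorem phiProb_zero (p : ℝ) (P : Finset (Plaquette d L)) :
    phiProb p 0 P = prob (ZMod 2) p 2 P := by
  have h : ∀ Q : Finset (Plaquette d L), phiWeight p 0 Q = weight (ZMod 2) p 2 Q := fun Q => by
    unfold phiWeight
    rw [if_pos (isNullHomologousIn_zero Q)]
  unfold phiProb phiSum prob partitionFn
  rw [h]
  exact congrArg _ (Finset.sum_congr rfl fun Q _ => h Q)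

/-! ### Surfaces with boundary `γ` inside a plaquette set: `S_γ(P)` -/

/-- `S_γ(P) = {η ∈ Ω²(𝕋;ℤ₂) : supp η ⊆ P, ∂η = γ}` ("`{P' ⊆ P : ∂P' = γ}`").
[cite: ForsstromViklund2025currents, §5 proof of Thm. 1.3 (S_γ(P'))] -/
def surfaces (γ : Site d L → Fin d → ZMod 2) (P : Finset (Plaquette d L)) :
    Finset (Plaquette d L → ZMod 2) :=
  Finset.univ.filter fun η => supp η ⊆ P ∧ bd₂ η = γ

/-- Membership in `S_γ(P)`. [cite: ForsstromViklund2025currents, §5 proof of Thm. 1.3 (S_γ(P'))] -/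
theorem mem_surfaces {γ : Site d L → Fin d → ZMod 2} {P : Finset (Plaquette d L)}
    {η : Plaquette d L → ZMod 2} : η ∈ surfaces γ P ↔ supp η ⊆ P ∧ bd₂ η = γ := by
  simp [surfaces]

/-- `supp η ⊆ P` iff `η` vanishes off `P`. [cite: ForsstromViklund2025currents, §1.3 ((supp ω)⁺)] -/
theorem supp_subset_iff {M : Type*} [Zero M] [DecidableEq M] (η : Plaquette d L → M)
    (P : Finset (Plaquette d L)) : supp η ⊆ P ↔ ∀ σ, σ ∉ P → η σ = 0 := by
  constructor
  · intro h σ hσ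
    by_contra hne
    exact hσ (h ((mem_supp η σ).mpr hne))
  · intro h σ hσ
    by_contra hσP
    exact (mem_supp η σ).mp hσ (h σ hσP)

/-- `S_γ(P) ≠ ∅ ⇔ P ∈ 𝒫_γ`. [cite: ForsstromViklund2025currents, §5 proof of Thm. 1.3 ("since P' ∈ 𝒫_γ, the set S_γ(P') is non-empty")] -/
theorem surfaces_nonempty_iff (γ : Site d L → Fin d → ZMod 2) (P : Finset (Plaquette d L)) :
    (surfaces γ P).Nonempty ↔ IsNullHomologousIn P γ := by
  constructor
  · rintro ⟨η, hη⟩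
    rw [mem_surfaces] at hη
    exact ⟨η, (supp_subset_iff η P).mp hη.1, hη.2⟩
  · rintro ⟨c, hc, hcγ⟩
    exact ⟨c, mem_surfaces.mpr ⟨(supp_subset_iff c P).mpr hc, hcγ⟩⟩

/-- `∂` is additive on `ℤ₂` `2`-forms. [cite: DuncanSchweinhart2025, §2.1 (∂ linear)] -/
theorem bd₂_add (η c : Plaquette d L → ZMod 2) : bd₂ (η + c) = bd₂ η + bd₂ c := by
  have := (bd₂Lin (d := d) (L := L) (ZMod 2)).map_add η c
  simpa only [bd₂Lin_apply] using this

/-- **`|S_γ(P)| = |S_0(P)|` when `P ∈ 𝒫_γ`** ("the map `P' ↦ P' Δ P₀` is a bijection from `S_γ(P')`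
to `S_0(P')`"), and `S_γ(P) = ∅` otherwise; `S_0(P) = Z₂(P(P); 𝔽₂)`.
[cite: ForsstromViklund2025currents, §5 proof of Thm. 1.3 (|S_γ(P')| = |S_0(P')|)] -/
theorem card_surfaces_eq (γ : Site d L → Fin d → ZMod 2) (P : Finset (Plaquette d L))
    [Decidable (IsNullHomologousIn P γ)] :
    (surfaces γ P).card =
      if IsNullHomologousIn P γ then Nat.card (twoCycles (ZMod 2) P) else 0 := by
  classical
  have h2 : ∀ a : ZMod 2, a + a = 0 := by decide
  split_ifs with hP
  · obtain ⟨c, hc, hcγ⟩ := hP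
    have hcS : supp c ⊆ P := (supp_subset_iff c P).mpr hc
    -- `S_0(P)` is the finset of the submodule `Z₂(P(P); 𝔽₂)`
    have h0 : (surfaces 0 P).card = Nat.card (twoCycles (ZMod 2) P) := by
      rw [Nat.card_eq_fintype_card, Fintype.card_subtype]
      congr 1
      ext η
      rw [mem_surfaces, Finset.mem_filter, mem_twoCycles, supp_subset_iff]
      simp
    rw [← h0]
    -- the switch `η ↦ η + c`
    refine Finset.card_bij (fun η _ => η + c) ?_ ?_ ?_
    · intro η hη
      rw [mem_surfaces] at hη ⊢
      refine ⟨?_, ?_⟩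
      · intro σ hσ
        rw [mem_supp, Pi.add_apply] at hσ
        by_contra hσP
        have h1 : η σ = 0 := (supp_subset_iff η P).mp hη.1 σ hσP
        have h3 : c σ = 0 := hc σ hσP
        rw [h1, h3, add_zero] at hσ
        exact hσ rfl
      · rw [bd₂_add, hη.2, hcγ]
        funext x k
        exact h2 _
    · intro η _ η' _ h
      simpa using congrArg (· + c) h
    · intro ζ hζ
      rw [mem_surfaces] at hζ
      refine ⟨ζ + c, ?_, ?_⟩
      · rw [mem_surfaces]
        refine ⟨?_, ?_⟩
        · intro σ hσ
          rw [mem_supp, Pi.add_apply] at hσ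
          by_contra hσP
          have h1 : ζ σ = 0 := (supp_subset_iff ζ P).mp hζ.1 σ hσP
          have h3 : c σ = 0 := hc σ hσP
          rw [h1, h3, add_zero] at hσ
          exact hσ rfl
        · rw [bd₂_add, hζ.2, hcγ, zero_add]
      · funext σ
        simp only [Pi.add_apply]
        rw [add_assoc, h2, add_zero]
  · rw [Finset.card_eq_zero, ← Finset.not_nonempty_iff_eq_empty, surfaces_nonempty_iff]
    exact hP

/-- `|Z₂(P(P); 𝔽₂)| = 2^{b₂(P)}` (`dim Z₂ = b₂`, `finrank_twoCycles`). [cite: DuncanSchweinhart2025, §3 Prop. 15] -/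
theorem natCard_twoCycles (P : Finset (Plaquette d L)) :
    Nat.card (twoCycles (ZMod 2) P) = 2 ^ bettiTwo (ZMod 2) P := by
  rw [Module.natCard_eq_pow_finrank (K := ZMod 2), Nat.card_zmod, finrank_twoCycles]

/-! ### The `φ^γ`-weights at `p = 1 - e^{-4β}` through `|S_γ(P)|` -/

/-- `1 - e^{-4β} = 2 sinh(2β) e^{-2β}`. [cite: ForsstromViklund2025currents, §5 proof of Thm. 1.3 (p₂, p₃)] -/
theorem one_sub_exp_neg_four (β : ℝ) :
    1 - Real.exp (-(4 * β)) = 2 * Real.sinh (2 * β) * Real.exp (-(2 * β)) := by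
  rw [Real.sinh_eq, show -(4 * β) = -(2 * β) + -(2 * β) by ring, Real.exp_add]
  have h : Real.exp (2 * β) * Real.exp (-(2 * β)) = 1 := by
    rw [← Real.exp_add, add_neg_cancel, Real.exp_zero]
  nlinarith [h]

/-- `e^{-4β} = (e^{-2β})²`. [cite: ForsstromViklund2025currents, §5 proof of Thm. 1.3] -/
theorem exp_neg_four_eq_sq (β : ℝ) : Real.exp (-(4 * β)) = Real.exp (-(2 * β)) ^ 2 := by
  rw [sq, ← Real.exp_add]; congr 1; ring

/-- `1 - tanh 2β = e^{-2β}/cosh 2β`. [cite: ForsstromViklund2025currents, §5 proof of Thm. 1.3 ((1 - tanh 2β)^{|C ∖ η'|})] -/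
theorem one_sub_tanh (β : ℝ) : 1 - Real.tanh (2 * β) = Real.exp (-(2 * β)) / Real.cosh (2 * β) := by
  have hc : Real.cosh (2 * β) ≠ 0 := (Real.cosh_pos _).ne'
  rw [Real.tanh_eq_sinh_div_cosh, ← Real.cosh_sub_sinh]
  field_simp

/-- The constant `dim C¹(𝕋;𝔽₂) - dim B¹(𝕋;𝔽₂)` of the Euler–Poincaré relation (`weight_mul_pow_card`).
[cite: DuncanSchweinhart2025, §3 Prop. 15 (the constant c(N,i,d))] -/
noncomputable def epConst (d L : ℕ) [NeZero L] : ℕ :=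
  finrank (ZMod 2) (Site d L → Fin d → ZMod 2) -
    finrank (ZMod 2) (gradCochains (d := d) (L := L) (ZMod 2) (ZMod 2))

/-- **The `φ^γ_β`-weights through surfaces**: for every `β` and `P`,
`φ^γ-weight_{1-e^{-4β}}(P) = 2^{c} e^{-2β|C₂⁺|} · |S_γ(P)| (sinh 2β)^{|P|} (e^{-2β})^{|Pᶜ|}`
(`c = dim C¹ - dim B¹`): the Euler–Poincaré step "`2^{𝐛₁(P')} = 2^{|C₁⁺| - |P'|} |S_0(P')|`" of the
printed proof. [cite: ForsstromViklund2025currents, §5 proof of Thm. 1.3 (c), (d)] -/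
theorem phiWeight_eq (β : ℝ) (γ : Site d L → Fin d → ZMod 2) (P : Finset (Plaquette d L)) :
    phiWeight (1 - Real.exp (-(4 * β))) γ P =
      2 ^ epConst d L * Real.exp (-(2 * β)) ^ Fintype.card (Plaquette d L) *
        ((surfaces γ P).card * (Real.sinh (2 * β) ^ P.card * Real.exp (-(2 * β)) ^ Pᶜ.card)) := by
  classical
  rw [card_surfaces_eq]
  unfold phiWeight
  split_ifs with hP
  · have hw := weight_mul_pow_card (d := d) (L := L) (ZMod 2) (1 - Real.exp (-(4 * β))) 2 P
    rw [← finrank_twoCycles] at hw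
    have h2P : (2 : ℝ) ^ P.card ≠ 0 := pow_ne_zero _ two_ne_zero
    have hcard : P.card + Pᶜ.card = Fintype.card (Plaquette d L) := Finset.card_add_card_compl P
    rw [natCard_twoCycles, ← finrank_twoCycles, Nat.cast_pow, Nat.cast_ofNat, ← hcard]
    -- `weight = (weight * 2^{|P|}) / 2^{|P|}`
    rw [show weight (ZMod 2) (1 - Real.exp (-(4 * β))) 2 P =
      weight (ZMod 2) (1 - Real.exp (-(4 * β))) 2 P * 2 ^ P.card / 2 ^ P.card by
        rw [mul_div_cancel_right₀ _ h2P], hw]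
    unfold epConst
    rw [one_sub_exp_neg_four, show (1 - 2 * Real.sinh (2 * β) * Real.exp (-(2 * β))) =
      Real.exp (-(2 * β)) ^ 2 by rw [← one_sub_exp_neg_four, exp_neg_four_eq_sq]; ring]
    rw [mul_pow, mul_pow, ← pow_mul, pow_add]
    field_simp
    ring
  · simp

/-! ### Theorem 1.3 (c), first form, and (d): `supp(max(η, X₂)) ∼ φ^γ_β`, `η ∣ P ∼ unif S_γ(P)` -/

/-- The terms of the joint law of `(η, supp η ∪ X₂)`, `X₂ ∼ Ψ_{tanh 2β}`:
`𝟙[∂η = γ] (tanh 2β)^{|supp η|} Ψ_{tanh 2β}(supp η ∪ X = P) = 𝟙[η ∈ S_γ(P)] (tanh 2β)^{|P|} (1-tanh 2β)^{|Pᶜ|}`.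
[cite: ForsstromViklund2025currents, §5 proof of Thm. 1.3 (the law ℙ((η, η')))] -/
theorem htWeight_mul_bernoulli_union (β : ℝ) (γ : Site d L → Fin d → ZMod 2)
    (η : Plaquette d L → ZMod 2) (P : Finset (Plaquette d L)) :
    (if bd₂ η = γ then htWeight β η else 0) *
        eventProb (ZMod 2) (Real.tanh (2 * β)) 1 {X | supp η ∪ X = P} =
      if η ∈ surfaces γ P then
        Real.tanh (2 * β) ^ P.card * (1 - Real.tanh (2 * β)) ^ Pᶜ.card else 0 := by
  classical
  rw [bernoulli_eventProb_union_eq]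
  by_cases hη : η ∈ surfaces γ P
  · have hη' := mem_surfaces.mp hη
    rw [if_pos hη, if_pos hη'.2, if_pos hη'.1, htWeight, ← mul_assoc, ← pow_add, add_comm,
      Finset.card_sdiff_add_card_eq_card hη'.1]
  · rw [if_neg hη]
    rw [mem_surfaces, not_and_or] at hη
    rcases hη with h | h
    · rw [if_neg h, mul_zero]
    · rw [if_neg h, zero_mul]

/-- `(tanh 2β)^{|P|} (1 - tanh 2β)^{|Pᶜ|} = (sinh 2β)^{|P|} (e^{-2β})^{|Pᶜ|} / (cosh 2β)^{|C₂⁺|}`.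
[cite: ForsstromViklund2025currents, §5 proof of Thm. 1.3 (second display)] -/
theorem tanh_pow_mul_pow (β : ℝ) (P : Finset (Plaquette d L)) :
    Real.tanh (2 * β) ^ P.card * (1 - Real.tanh (2 * β)) ^ Pᶜ.card =
      Real.sinh (2 * β) ^ P.card * Real.exp (-(2 * β)) ^ Pᶜ.card /
        Real.cosh (2 * β) ^ Fintype.card (Plaquette d L) := by
  have hc : Real.cosh (2 * β) ≠ 0 := (Real.cosh_pos _).ne'
  rw [one_sub_tanh, Real.tanh_eq_sinh_div_cosh, div_pow, div_pow, ← Finset.card_add_card_compl P,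
    pow_add]
  field_simp

/-- **The un-normalised joint law summed over `η`**: `Σ_η 𝟙[∂η=γ](tanh 2β)^{|η|} Ψ_{tanh 2β}(supp η ∪ X = P)
= φ^γ-weight_{1-e^{-4β}}(P) / (2^{c} e^{-2β|C₂⁺|} (cosh 2β)^{|C₂⁺|})`.
[cite: ForsstromViklund2025currents, §5 proof of Thm. 1.3 ("the measures ℙ and ℙ̂ are equal")] -/
theorem sum_htWeight_mul_bernoulli_union (β : ℝ) (γ : Site d L → Fin d → ZMod 2)
    (P : Finset (Plaquette d L)) :
    ∑ η : Plaquette d L → ZMod 2, (if bd₂ η = γ then htWeight β η else 0) *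
        eventProb (ZMod 2) (Real.tanh (2 * β)) 1 {X | supp η ∪ X = P} =
      phiWeight (1 - Real.exp (-(4 * β))) γ P /
        (2 ^ epConst d L * Real.exp (-(2 * β)) ^ Fintype.card (Plaquette d L) *
          Real.cosh (2 * β) ^ Fintype.card (Plaquette d L)) := by
  classical
  have hc : Real.cosh (2 * β) ^ Fintype.card (Plaquette d L) ≠ 0 := pow_ne_zero _ (Real.cosh_pos _).ne'
  have he : Real.exp (-(2 * β)) ^ Fintype.card (Plaquette d L) ≠ 0 := pow_ne_zero _ (Real.exp_pos _).ne'
  have h2 : (2 : ℝ) ^ epConst d L ≠ 0 := pow_ne_zero _ two_ne_zero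
  simp_rw [htWeight_mul_bernoulli_union]
  rw [Finset.sum_ite_mem, Finset.univ_inter, Finset.sum_const, nsmul_eq_mul, tanh_pow_mul_pow,
    phiWeight_eq]
  field_simp

/-- Bernoulli sprinkling is a probability: `Σ_P Ψ_r(S ∪ X = P) = 1`. [cite: ForsstromViklund2025currents, Thm. 1.3 (Ψ_p)] -/
theorem sum_bernoulli_eventProb_union (F : Type*) [Field F] (r : ℝ) (S : Finset (Plaquette d L)) :
    ∑ P : Finset (Plaquette d L), eventProb F r 1 {X | S ∪ X = P} = 1 := by
  classical
  have h := sum_eventProb_union_eq (d := d) (L := L) F r 1 S Set.univ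
  have hfilter : Finset.univ.filter (fun P : Finset (Plaquette d L) => P ∈ (Set.univ : Set _)) =
      Finset.univ := by
    ext P; simp
  rw [hfilter] at h
  rw [h]
  unfold eventProb prob
  simp only [Set.mem_univ, Set.setOf_true, if_true, partitionFn_one, div_one]
  exact partitionFn_one (d := d) (L := L) F r

/-- **The high-temperature and the `φ^γ` partition sums agree up to the constant**:
`Σ_{η : ∂η = γ} (tanh 2β)^{|supp η|} = φ^γ-sum_{1-e^{-4β}} / (2^{c} e^{-2β|C₂⁺|} (cosh 2β)^{|C₂⁺|})`.
[cite: ForsstromViklund2025currents, §5 proof of Thm. 1.3 (Z_0, Z_1)] -/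
theorem htSum_eq_phiSum (β : ℝ) (γ : Site d L → Fin d → ZMod 2) :
    htSum β γ = phiSum (1 - Real.exp (-(4 * β))) γ /
      (2 ^ epConst d L * Real.exp (-(2 * β)) ^ Fintype.card (Plaquette d L) *
        Real.cosh (2 * β) ^ Fintype.card (Plaquette d L)) := by
  classical
  unfold phiSum
  rw [Finset.sum_div]
  simp_rw [← sum_htWeight_mul_bernoulli_union]
  rw [Finset.sum_comm]
  unfold htSum
  refine Finset.sum_congr rfl fun η _ => ?_
  rw [← Finset.mul_sum, sum_bernoulli_eventProb_union, mul_one]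

/-- `φ^γ-sum > 0` for `β > 0` and `γ` a `ℤ₂`-boundary. [cite: ForsstromViklund2025currents, §1.3 (φ^γ_{B_N,p})] -/
theorem phiSum_pos {β : ℝ} (hβ : 0 < β) {γ : Site d L → Fin d → ZMod 2}
    (hγ : ∃ c : Plaquette d L → ZMod 2, bd₂ c = γ) : 0 < phiSum (1 - Real.exp (-(4 * β))) γ := by
  have h := htSum_eq_phiSum β γ
  have hpos : 0 < (2 : ℝ) ^ epConst d L * Real.exp (-(2 * β)) ^ Fintype.card (Plaquette d L) *
      Real.cosh (2 * β) ^ Fintype.card (Plaquette d L) := by positivity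
  have hT := htSum_pos hβ hγ
  rw [h] at hT
  exact (div_pos_iff_of_pos_right hpos).mp hT

/-- **Theorem 1.3 (c) (Forsström–Viklund), first form, PROVED on the torus**: for `β > 0`, a
`ℤ₂`-boundary `γ` and every plaquette set `P`,
`Σ_η P^γ_β(η) Ψ_{tanh 2β}({X : supp η ∪ X = P}) = φ^γ_{1-e^{-4β}}(P)` — the support of
`ω = max(η, X₂)`, `η ∼ P^γ_β`, `X₂ ∼ Ψ_{tanh 2β}` independent, has the law of the random-cluster
model with boundary `γ`. [cite: ForsstromViklund2025currents, Thm. 1.3 (c)] -/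
theorem sum_htProb_bernoulli_eq_phiProb {β : ℝ} (hβ : 0 < β) {γ : Site d L → Fin d → ZMod 2}
    (hγ : ∃ c : Plaquette d L → ZMod 2, bd₂ c = γ) (P : Finset (Plaquette d L)) :
    ∑ η : Plaquette d L → ZMod 2, htProb β γ η *
        eventProb (ZMod 2) (Real.tanh (2 * β)) 1 {X | supp η ∪ X = P} =
      phiProb (1 - Real.exp (-(4 * β))) γ P := by
  have hT := (htSum_pos hβ hγ).ne'
  have hS := (phiSum_pos hβ hγ).ne'
  have hc : Real.cosh (2 * β) ^ Fintype.card (Plaquette d L) ≠ 0 := pow_ne_zero _ (Real.cosh_pos _).ne'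
  have he : Real.exp (-(2 * β)) ^ Fintype.card (Plaquette d L) ≠ 0 := pow_ne_zero _ (Real.exp_pos _).ne'
  have h2 : (2 : ℝ) ^ epConst d L ≠ 0 := pow_ne_zero _ two_ne_zero
  have hterm : ∀ η : Plaquette d L → ZMod 2, htProb β γ η *
      eventProb (ZMod 2) (Real.tanh (2 * β)) 1 {X | supp η ∪ X = P} =
      ((if bd₂ η = γ then htWeight β η else 0) *
        eventProb (ZMod 2) (Real.tanh (2 * β)) 1 {X | supp η ∪ X = P}) / htSum β γ := by
    intro η
    unfold htProb
    ring
  simp_rw [hterm]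
  rw [← Finset.sum_div, sum_htWeight_mul_bernoulli_union, htSum_eq_phiSum, phiProb]
  field_simp

/-- **Theorem 1.3 (d) (Forsström–Viklund), PROVED on the torus, as the joint law**: for `β > 0`, a
`ℤ₂`-boundary `γ`, every `η` and `P`,
`P^γ_β(η) Ψ_{tanh 2β}(supp η ∪ X = P) = φ^γ_{1-e^{-4β}}(P) · 𝟙[η ∈ S_γ(P)] / |S_γ(P)|` — i.e. the
pair `(η, supp max(η, X₂))` has the law of `(η', P)` with `P ∼ φ^γ` and, given `P`, `η'` uniform on
`S_γ(P) = {P' ⊆ P : ∂P' = γ}`; in particular `η' ∼ P^γ_β` (marginal in `η`).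
[cite: ForsstromViklund2025currents, Thm. 1.3 (d)] -/
theorem htProb_mul_bernoulli_eq_phiProb_mul {β : ℝ} (hβ : 0 < β) {γ : Site d L → Fin d → ZMod 2}
    (hγ : ∃ c : Plaquette d L → ZMod 2, bd₂ c = γ) (η : Plaquette d L → ZMod 2)
    (P : Finset (Plaquette d L)) :
    htProb β γ η * eventProb (ZMod 2) (Real.tanh (2 * β)) 1 {X | supp η ∪ X = P} =
      phiProb (1 - Real.exp (-(4 * β))) γ P *
        (if η ∈ surfaces γ P then ((surfaces γ P).card : ℝ)⁻¹ else 0) := by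
  classical
  have hT := (htSum_pos hβ hγ).ne'
  have hS := (phiSum_pos hβ hγ).ne'
  have hc : Real.cosh (2 * β) ^ Fintype.card (Plaquette d L) ≠ 0 := pow_ne_zero _ (Real.cosh_pos _).ne'
  have he : Real.exp (-(2 * β)) ^ Fintype.card (Plaquette d L) ≠ 0 := pow_ne_zero _ (Real.exp_pos _).ne'
  have h2 : (2 : ℝ) ^ epConst d L ≠ 0 := pow_ne_zero _ two_ne_zero
  have hlhs : htProb β γ η * eventProb (ZMod 2) (Real.tanh (2 * β)) 1 {X | supp η ∪ X = P} =
      ((if bd₂ η = γ then htWeight β η else 0) *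
        eventProb (ZMod 2) (Real.tanh (2 * β)) 1 {X | supp η ∪ X = P}) / htSum β γ := by
    unfold htProb
    ring
  rw [hlhs, htWeight_mul_bernoulli_union, htSum_eq_phiSum, phiProb, phiWeight_eq, tanh_pow_mul_pow]
  by_cases hη : η ∈ surfaces γ P
  · have hcard : ((surfaces γ P).card : ℝ) ≠ 0 := by
      exact_mod_cast (Finset.card_pos.mpr ⟨η, hη⟩).ne'
    rw [if_pos hη, if_pos hη]
    field_simp
  · rw [if_neg hη, if_neg hη, mul_zero, zero_div]

/-! ### Theorem 1.3 (c), second form: `max(n̂, X₃) ∼ φ^γ_β`, `X₃ ∼ Ψ_{1-e^{-2β}}` -/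

/-- **Sprinkling `Ψ_{1-e^{-2β}}` on the fibres of `(n mod 2, n̂)`**: for `η` with `∂η = γ`... for every
`η` and `P`, `Σ_N ∏_p t(2β, η(p), p ∈ N) · Ψ_{1-e^{-2β}}(N ∪ X = P) =
𝟙[supp η ⊆ P] (sinh 2β)^{|P|} (e^{-2β})^{|Pᶜ|}` (binomial theorem over `supp η ⊆ N ⊆ P`:
`cosh 2β - 1 + (1 - e^{-2β}) = sinh 2β`). [cite: ForsstromViklund2025currents, Thm. 1.3 (c) (max(n̂, X₃))] -/
theorem sum_prod_traceFactor_mul_bernoulli_union (β : ℝ) (η : Plaquette d L → ZMod 2)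
    (P : Finset (Plaquette d L)) :
    ∑ N : Finset (Plaquette d L), (∏ p, traceFactor (2 * β) (η p) (p ∈ N)) *
        eventProb (ZMod 2) (1 - Real.exp (-(2 * β))) 1 {X | N ∪ X = P} =
      if supp η ⊆ P then Real.sinh (2 * β) ^ P.card * Real.exp (-(2 * β)) ^ Pᶜ.card else 0 := by
  classical
  simp_rw [prod_traceFactor_eq, bernoulli_eventProb_union_eq]
  split_ifs with hηP
  · -- reindex `N` with `supp η ⊆ N ⊆ P` by `M = N \ supp η ⊆ P \ supp η`
    set S := supp η with hSdef
    set s := Real.sinh (2 * β)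
    set a := Real.cosh (2 * β) - 1
    set b := 1 - Real.exp (-(2 * β))
    have hab : a + b = s := by
      simp only [a, b, s]
      have := Real.cosh_sub_sinh (2 * β)
      linarith
    have hsummand : ∀ N : Finset (Plaquette d L),
        (if S ⊆ N then s ^ S.card * a ^ (N \ S).card else 0) *
          (if N ⊆ P then b ^ (P \ N).card * (1 - b) ^ Pᶜ.card else 0) =
        if S ⊆ N ∧ N ⊆ P then
          s ^ S.card * a ^ (N \ S).card * (b ^ (P \ N).card * (1 - b) ^ Pᶜ.card) else 0 := by
      intro N
      by_cases h1 : S ⊆ N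
      · by_cases h2 : N ⊆ P
        · rw [if_pos h1, if_pos h2, if_pos ⟨h1, h2⟩]
        · rw [if_pos h1, if_neg h2, if_neg (show ¬(S ⊆ N ∧ N ⊆ P) from fun h => h2 h.2), mul_zero]
      · rw [if_neg h1, if_neg (show ¬(S ⊆ N ∧ N ⊆ P) from fun h => h1 h.1), zero_mul]
    have key : ∑ N : Finset (Plaquette d L),
        (if S ⊆ N then s ^ S.card * a ^ (N \ S).card else 0) *
          (if N ⊆ P then b ^ (P \ N).card * (1 - b) ^ Pᶜ.card else 0) =
        ∑ M ∈ (P \ S).powerset, s ^ S.card * (1 - b) ^ Pᶜ.card *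
          (a ^ M.card * b ^ ((P \ S).card - M.card)) := by
      rw [Finset.sum_congr rfl (fun N _ => hsummand N), ← Finset.sum_filter]
      refine Finset.sum_nbij' (fun N => N \ S) (fun M => S ∪ M) ?_ ?_ ?_ ?_ ?_
      · intro N hN
        rw [Finset.mem_filter] at hN
        rw [Finset.mem_powerset]
        exact Finset.sdiff_subset_sdiff hN.2.2 le_rfl
      · intro M hM
        rw [Finset.mem_powerset] at hM
        rw [Finset.mem_filter]
        exact ⟨Finset.mem_univ _, Finset.subset_union_left,
          Finset.union_subset hηP (hM.trans Finset.sdiff_subset)⟩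
      · intro N hN
        rw [Finset.mem_filter] at hN
        exact Finset.union_sdiff_of_subset hN.2.1
      · intro M hM
        rw [Finset.mem_powerset] at hM
        rw [Finset.union_sdiff_left]
        exact Finset.sdiff_eq_self_of_disjoint
          (Finset.disjoint_of_subset_left hM Finset.sdiff_disjoint)
      · intro N hN
        rw [Finset.mem_filter] at hN
        obtain ⟨_, hSN, hNP⟩ := hN
        have hcard : (P \ N).card = (P \ S).card - (N \ S).card := by
          have h1 := Finset.card_sdiff_add_card_eq_card hNP
          have h2 := Finset.card_sdiff_add_card_eq_card hSN
          have h3 := Finset.card_sdiff_add_card_eq_card (hSN.trans hNP)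
          omega
        rw [hcard]
        ring
    rw [key, ← Finset.mul_sum, Finset.sum_pow_mul_eq_add_pow, hab, ← Finset.card_sdiff_add_card_eq_card hηP]
    simp only [b, sub_sub_cancel]
    ring
  · refine Finset.sum_eq_zero fun N _ => ?_
    by_cases hSN : supp η ⊆ N
    · by_cases hNP : N ⊆ P
      · exact absurd (hSN.trans hNP) hηP
      · rw [if_neg hNP, mul_zero]
    · rw [if_neg hSN, zero_mul]


/-- The fibres of `n ↦ (n mod 2, n̂)` inside `𝒞_γ` (the companion's `hasSum_currentWeight_parity_supp`
with the source condition, which depends on `n` only through `n mod 2`).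
[cite: ForsstromViklund2025currents, §5 proof of Thm. 1.3 (b)] -/
theorem hasSum_currentWeight_source_parity_supp (β : ℝ) (γ : Site d L → Fin d → ZMod 2)
    (η : Plaquette d L → ZMod 2) (N : Finset (Plaquette d L)) :
    HasSum (fun n : Current d L =>
        if IsSourceOf γ n ∧ (parity n = η ∧ supp n = N) then currentWeight β n else 0)
      (if bd₂ η = γ then ∏ p, traceFactor (2 * β) (η p) (p ∈ N) else 0) := by
  by_cases hη : bd₂ η = γ
  · rw [if_pos hη]
    convert hasSum_currentWeight_parity_supp β η N using 1
    funext n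
    by_cases hp : parity n = η ∧ supp n = N
    · have hs : IsSourceOf γ n := by rw [isSourceOf_iff_parity, hp.1, hη]
      rw [if_pos ⟨hs, hp⟩, if_pos hp]
    · rw [if_neg (fun h => hp h.2), if_neg hp]
  · rw [if_neg hη]
    have hfun : (fun n : Current d L =>
        if IsSourceOf γ n ∧ (parity n = η ∧ supp n = N) then currentWeight β n else 0) = fun _ => 0 := by
      funext n
      rw [if_neg]
      rintro ⟨hs, hp, _⟩
      rw [isSourceOf_iff_parity, hp] at hs
      exact hη hs
    rw [hfun]
    exact hasSum_zero

/-- **Theorem 1.3 (c) (Forsström–Viklund), second form, PROVED on the torus**: for `β > 0`, a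
`ℤ₂`-boundary `γ` and every plaquette set `P`,
`Σ_n 𝐏^γ_β(n) Ψ_{1-e^{-2β}}({X : n̂ ∪ X = P}) = φ^γ_{1-e^{-4β}}(P)` — `max(n̂, X₃)` with `n ∼ 𝐏^γ_β`,
`X₃ ∼ Ψ_{1-e^{-2β}}` independent has the law of the random-cluster model with boundary `γ`
("`max(η, X₂) =ᵈ max(n̂, X₃)`"). Proof here: fibres of `(n mod 2, n̂)` and the binomial theorem
(`cosh 2β - 1 + (1 - e^{-2β}) = sinh 2β`). [cite: ForsstromViklund2025currents, Thm. 1.3 (c)] -/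
theorem hasSum_curProb_bernoulli_union {β : ℝ} (hβ : 0 < β) {γ : Site d L → Fin d → ZMod 2}
    (hγ : ∃ c : Plaquette d L → ZMod 2, bd₂ c = γ) (P : Finset (Plaquette d L)) :
    HasSum (fun n : Current d L => curProb β γ n *
        eventProb (ZMod 2) (1 - Real.exp (-(2 * β))) 1 {X | supp n ∪ X = P})
      (phiProb (1 - Real.exp (-(4 * β))) γ P) := by
  classical
  have hS := (phiSum_pos hβ hγ).ne'
  have hT := (htSum_pos hβ hγ).ne'
  have hc : Real.cosh (2 * β) ^ Fintype.card (Plaquette d L) ≠ 0 := pow_ne_zero _ (Real.cosh_pos _).ne'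
  have he : Real.exp (-(2 * β)) ^ Fintype.card (Plaquette d L) ≠ 0 := pow_ne_zero _ (Real.exp_pos _).ne'
  have h2 : (2 : ℝ) ^ epConst d L ≠ 0 := pow_ne_zero _ two_ne_zero
  -- sum the fibres of `(n mod 2, n̂)` against the sprinkling probabilities
  have hηN : ∀ η : Plaquette d L → ZMod 2, HasSum (fun n : Current d L =>
      ∑ N : Finset (Plaquette d L),
        (if IsSourceOf γ n ∧ (parity n = η ∧ supp n = N) then currentWeight β n else 0) *
          eventProb (ZMod 2) (1 - Real.exp (-(2 * β))) 1 {X | N ∪ X = P})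
      (∑ N : Finset (Plaquette d L),
        (if bd₂ η = γ then ∏ p, traceFactor (2 * β) (η p) (p ∈ N) else 0) *
          eventProb (ZMod 2) (1 - Real.exp (-(2 * β))) 1 {X | N ∪ X = P}) :=
    fun η => hasSum_sum fun N _ => (hasSum_currentWeight_source_parity_supp β γ η N).mul_right _
  have hall := hasSum_sum (s := (Finset.univ : Finset (Plaquette d L → ZMod 2))) fun η _ => hηN η
  have hfun : (fun n : Current d L => ∑ η : Plaquette d L → ZMod 2, ∑ N : Finset (Plaquette d L),
      (if IsSourceOf γ n ∧ (parity n = η ∧ supp n = N) then currentWeight β n else 0) *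
        eventProb (ZMod 2) (1 - Real.exp (-(2 * β))) 1 {X | N ∪ X = P}) =
      fun n => (if IsSourceOf γ n then currentWeight β n else 0) *
        eventProb (ZMod 2) (1 - Real.exp (-(2 * β))) 1 {X | supp n ∪ X = P} := by
    funext n
    rw [Finset.sum_eq_single (parity n)]
    · rw [Finset.sum_eq_single (supp n)]
      · by_cases hs : IsSourceOf γ n
        · rw [if_pos ⟨hs, rfl, rfl⟩, if_pos hs]
        · rw [if_neg (fun h => hs h.1), if_neg hs]
      · intro N _ hN
        rw [if_neg (fun h => hN h.2.2.symm), zero_mul]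
      · intro h; exact absurd (Finset.mem_univ _) h
    · intro η _ hη
      exact Finset.sum_eq_zero fun N _ => by rw [if_neg (fun h => hη h.2.1.symm), zero_mul]
    · intro h; exact absurd (Finset.mem_univ _) h
  rw [hfun] at hall
  -- the value of the sum
  have hval : (∑ η : Plaquette d L → ZMod 2, ∑ N : Finset (Plaquette d L),
      (if bd₂ η = γ then ∏ p, traceFactor (2 * β) (η p) (p ∈ N) else 0) *
        eventProb (ZMod 2) (1 - Real.exp (-(2 * β))) 1 {X | N ∪ X = P}) =
      phiWeight (1 - Real.exp (-(4 * β))) γ P /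
        (2 ^ epConst d L * Real.exp (-(2 * β)) ^ Fintype.card (Plaquette d L)) := by
    have hη : ∀ η : Plaquette d L → ZMod 2, (∑ N : Finset (Plaquette d L),
        (if bd₂ η = γ then ∏ p, traceFactor (2 * β) (η p) (p ∈ N) else 0) *
          eventProb (ZMod 2) (1 - Real.exp (-(2 * β))) 1 {X | N ∪ X = P}) =
        if η ∈ surfaces γ P then Real.sinh (2 * β) ^ P.card * Real.exp (-(2 * β)) ^ Pᶜ.card else 0 := by
      intro η
      by_cases hb : bd₂ η = γ
      · simp_rw [if_pos hb]
        rw [sum_prod_traceFactor_mul_bernoulli_union]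
        by_cases hsub : supp η ⊆ P
        · rw [if_pos hsub, if_pos (mem_surfaces.mpr ⟨hsub, hb⟩)]
        · rw [if_neg hsub, if_neg (fun h => hsub (mem_surfaces.mp h).1)]
      · simp_rw [if_neg hb, zero_mul, Finset.sum_const_zero]
        rw [if_neg (fun h => hb (mem_surfaces.mp h).2)]
    simp_rw [hη]
    rw [Finset.sum_ite_mem, Finset.univ_inter, Finset.sum_const, nsmul_eq_mul, phiWeight_eq]
    field_simp
  -- divide by `Σ_{𝒞_γ} w = (cosh 2β)^{|C|} htSum = φ^γ-sum / (2^c e^{-2β|C|})`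
  have hdiv := hall.div_const (curSum β γ)
  have hfun2 : (fun n : Current d L => (if IsSourceOf γ n then currentWeight β n else 0) *
      eventProb (ZMod 2) (1 - Real.exp (-(2 * β))) 1 {X | supp n ∪ X = P} / curSum β γ) =
      fun n => curProb β γ n *
        eventProb (ZMod 2) (1 - Real.exp (-(2 * β))) 1 {X | supp n ∪ X = P} := by
    funext n
    unfold curProb
    ring
  rw [hfun2, hval, curSum_eq_htSum, htSum_eq_phiSum] at hdiv
  have hfin : phiWeight (1 - Real.exp (-(4 * β))) γ P /
      (2 ^ epConst d L * Real.exp (-(2 * β)) ^ Fintype.card (Plaquette d L)) /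
      (Real.cosh (2 * β) ^ Fintype.card (Plaquette d L) *
        (phiSum (1 - Real.exp (-(4 * β))) γ /
          (2 ^ epConst d L * Real.exp (-(2 * β)) ^ Fintype.card (Plaquette d L) *
            Real.cosh (2 * β) ^ Fintype.card (Plaquette d L)))) =
      phiProb (1 - Real.exp (-(4 * β))) γ P := by
    unfold phiProb
    field_simp
  rw [hfin] at hdiv
  exact hdiv

/-! ### Proposition 6.7, upper half: `𝐏̂⁰_β ≤ φ⁰_β ≤ Ψ_{1-e^{-4β}}` -/

/-- `Ψ_r` of the sure event is `1` (`q = 1` weights sum to `1`). [cite: DuncanSchweinhart2025, §1.1 Def. 1 (q = 1)] -/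
theorem bernoulli_eventProb_univ (F : Type*) [Field F] (r : ℝ) :
    eventProb (d := d) (L := L) F r 1 Set.univ = 1 := by
  classical
  unfold eventProb prob
  simp only [Set.mem_univ, if_true, partitionFn_one, div_one]
  exact partitionFn_one (d := d) (L := L) F r

/-- `𝐏^γ_β(n) ≥ 0` for `β ≥ 0`. [cite: ForsstromViklund2025currents, §1.3 (𝐏^γ_{B_N,β})] -/
theorem curProb_nonneg {β : ℝ} (hβ : 0 ≤ β) (γ : Site d L → Fin d → ZMod 2) (n : Current d L) :
    0 ≤ curProb β γ n := by
  unfold curProb curSum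
  refine div_nonneg ?_ (tsum_currents_nonneg hβ γ)
  split_ifs
  · exact currentWeight_nonneg hβ n
  · exact le_rfl

/-- **`𝐏̂⁰_β(E) ≤ φ⁰_{1-e^{-4β}}(E)` for increasing events** ("`n̂ ≤ max(n̂, X₃) ∼ φ⁰`", Theorem 1.3 (c)):
the first step of the upper half of Proposition 6.7. [cite: ForsstromViklund2025currents, Prop. 6.7 (proof)] -/
theorem percProb_zero_le_rc {β : ℝ} (hβ : 0 < β) {E : Set (Finset (Plaquette d L))}
    [DecidablePred (· ∈ E)] (hE : IsUpperSet E) :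
    percProb β 0 E ≤ eventProb (ZMod 2) (1 - Real.exp (-(4 * β))) 2 E := by
  classical
  have hγ : ∃ c : Plaquette d L → ZMod 2, bd₂ c = 0 := ⟨0, bd₂_zero⟩
  have hp3 : (1 - Real.exp (-(2 * β))) ∈ Set.Icc (0 : ℝ) 1 := by
    constructor
    · rw [sub_nonneg]; exact Real.exp_le_one_iff.mpr (by linarith)
    · linarith [Real.exp_pos (-(2 * β))]
  -- `Σ_n 𝐏⁰(n) Ψ(n̂ ∪ X ∈ E) = φ⁰(E)`
  have h1 : HasSum (fun n : Current d L => curProb β 0 n *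
      eventProb (ZMod 2) (1 - Real.exp (-(2 * β))) 1 {X | supp n ∪ X ∈ E})
      (eventProb (ZMod 2) (1 - Real.exp (-(4 * β))) 2 E) := by
    have h := hasSum_sum (s := Finset.univ.filter (fun P : Finset (Plaquette d L) => P ∈ E))
      (fun P _ => hasSum_curProb_bernoulli_union hβ hγ P)
    have hfun : (fun n : Current d L => ∑ P ∈ Finset.univ.filter (fun P : Finset (Plaquette d L) => P ∈ E),
        curProb β 0 n * eventProb (ZMod 2) (1 - Real.exp (-(2 * β))) 1 {X | supp n ∪ X = P}) =
        fun n => curProb β 0 n *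
          eventProb (ZMod 2) (1 - Real.exp (-(2 * β))) 1 {X | supp n ∪ X ∈ E} := by
      funext n
      rw [← Finset.mul_sum, sum_eventProb_union_eq]
    have hval : ∑ P ∈ Finset.univ.filter (fun P : Finset (Plaquette d L) => P ∈ E),
        phiProb (1 - Real.exp (-(4 * β))) 0 P = eventProb (ZMod 2) (1 - Real.exp (-(4 * β))) 2 E := by
      unfold eventProb
      rw [Finset.sum_filter]
      refine Finset.sum_congr rfl fun P _ => ?_
      split_ifs
      · exact phiProb_zero _ P
      · rfl
    rw [hfun, hval] at h
    exact h
  -- `𝐏̂⁰(E) = Σ_n 𝟙[n̂ ∈ E] 𝐏⁰(n)`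
  have h0 := hasSum_sum (s := Finset.univ.filter (fun P : Finset (Plaquette d L) => P ∈ E))
    (fun P _ => hasSum_curProb_supp hβ hγ P)
  have hfun0 : (fun n : Current d L => ∑ P ∈ Finset.univ.filter (fun P : Finset (Plaquette d L) => P ∈ E),
      (if supp n = P then curProb β 0 n else 0)) = fun n => if supp n ∈ E then curProb β 0 n else 0 := by
    funext n
    by_cases hn : supp n ∈ E
    · rw [if_pos hn, Finset.sum_eq_single_of_mem (supp n)
        (Finset.mem_filter.mpr ⟨Finset.mem_univ _, hn⟩)]
      · rw [if_pos rfl]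
      · intro P _ hP
        rw [if_neg (Ne.symm hP)]
    · rw [if_neg hn]
      refine Finset.sum_eq_zero fun P hP => ?_
      rw [if_neg]
      rintro rfl
      exact hn (Finset.mem_filter.mp hP).2
  rw [hfun0] at h0
  have hle := hasSum_le (fun n => ?_) h0 h1
  · unfold percProb
    rw [h0.tsum_eq]
    exact hle
  · -- termwise: `𝟙[n̂ ∈ E] ≤ Ψ(n̂ ∪ X ∈ E)` (`E` increasing)
    by_cases hn : supp n ∈ E
    · have huniv : {X : Finset (Plaquette d L) | supp n ∪ X ∈ E} = Set.univ :=
        Set.eq_univ_iff_forall.mpr fun X => hE (Finset.subset_union_left : supp n ≤ supp n ∪ X) hn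
      rw [if_pos hn, huniv, bernoulli_eventProb_univ, mul_one]
    · rw [if_neg hn]
      exact mul_nonneg (curProb_nonneg hβ.le 0 n) (eventProb_nonneg (ZMod 2) hp3 zero_le_one _)

/-- **Proposition 6.7, upper half (Forsström–Viklund), PROVED on the torus**: for `β > 0` and every
increasing event `E` of plaquette sets, `𝐏̂⁰_β(E) ≤ Ψ_{1-e^{-4β}}(E)` ("by combining Proposition 6.6 and
Theorem 1.3": `n̂ ≤ max(n̂, X₃) ∼ φ⁰ ≤ Ψ_{1-e^{-4β}}`, the last step being the tree's
`PlaquetteRC.eventProb_sandwich`). [cite: ForsstromViklund2025currents, Prop. 6.7] -/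
theorem percProb_zero_le_bernoulli {β : ℝ} (hβ : 0 < β) {E : Set (Finset (Plaquette d L))}
    [DecidablePred (· ∈ E)] (hE : IsUpperSet E) :
    percProb β 0 E ≤ eventProb (ZMod 2) (1 - Real.exp (-(4 * β))) 1 E := by
  have hp : (1 - Real.exp (-(4 * β))) ∈ Set.Ioo (0 : ℝ) 1 := by
    constructor
    · rw [sub_pos]; exact Real.exp_lt_one_iff.mpr (by linarith)
    · linarith [Real.exp_pos (-(4 * β))]
  exact (percProb_zero_le_rc hβ hE).trans
    (eventProb_sandwich (ZMod 2) hp (by norm_num : (1 : ℝ) ≤ 2) hE).2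

/-- **Proposition 6.7 (Forsström–Viklund) on the torus, both halves**: for `β > 0` and increasing `E`,
`Ψ_{1-1/cosh 2β}(E) ≤ 𝐏̂⁰_β(E) ≤ Ψ_{1-e^{-4β}}(E)`. [cite: ForsstromViklund2025currents, Prop. 6.7] -/
theorem percProb_zero_sandwich {β : ℝ} (hβ : 0 < β) {E : Set (Finset (Plaquette d L))}
    [DecidablePred (· ∈ E)] (hE : IsUpperSet E) :
    eventProb (ZMod 2) (1 - (Real.cosh (2 * β))⁻¹) 1 E ≤ percProb β 0 E ∧
      percProb β 0 E ≤ eventProb (ZMod 2) (1 - Real.exp (-(4 * β))) 1 E :=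
  ⟨bernoulli_le_percProb hβ ⟨0, bd₂_zero⟩ hE, percProb_zero_le_bernoulli hβ hE⟩

/-! ### Remark after Theorem 1.3: `φ^γ_β` dominates `Ψ_{tanh 2β}` (Proposition 6.6, lower half, every `γ`) -/

/-- `tanh 2β ∈ [0, 1]` for `β ≥ 0`. [cite: ForsstromViklund2025currents, Thm. 1.3 (X₂ ∼ Ψ_{tanh 2β})] -/
theorem tanh_two_mul_mem_Icc {β : ℝ} (hβ : 0 ≤ β) : Real.tanh (2 * β) ∈ Set.Icc (0 : ℝ) 1 := by
  rw [Real.tanh_eq_sinh_div_cosh]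
  have hc := Real.cosh_pos (2 * β)
  refine ⟨div_nonneg (Real.sinh_nonneg_iff.mpr (by linarith)) hc.le, ?_⟩
  rw [div_le_one hc]
  have := Real.cosh_sub_sinh (2 * β)
  linarith [Real.exp_pos (-(2 * β))]

/-- **The random-cluster model with boundary `γ` stochastically dominates `Ψ_{tanh 2β}`** (the Remark
after Theorem 1.3: "Theorem 1.3 (c) immediately implies that `φ_{B_N,β}` stochastically dominates an iid
Bernoulli percolation process with parameter `p₂ = tanh 2β`"; = the lower half of Prop. 6.6, here for
every boundary `γ`), PROVED on the torus: for `β > 0`, a `ℤ₂`-boundary `γ` and every increasing event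
`E` of plaquette sets, `Ψ_{tanh 2β}(E) ≤ φ^γ_{1-e^{-4β}}(E) = Σ_{P ∈ E} φ^γ(P)` (since `supp max(η, X₂) ⊇ X₂`).
[cite: ForsstromViklund2025currents, Thm. 1.3 (Remark following it) and Prop. 6.6] -/
theorem bernoulli_le_sum_phiProb {β : ℝ} (hβ : 0 < β) {γ : Site d L → Fin d → ZMod 2}
    (hγ : ∃ c : Plaquette d L → ZMod 2, bd₂ c = γ) (E : Set (Finset (Plaquette d L)))
    [DecidablePred (· ∈ E)] (hE : IsUpperSet E) :
    eventProb (ZMod 2) (Real.tanh (2 * β)) 1 E ≤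
      ∑ P : Finset (Plaquette d L), (if P ∈ E then phiProb (1 - Real.exp (-(4 * β))) γ P else 0) := by
  classical
  have ht := tanh_two_mul_mem_Icc hβ.le
  -- `Σ_{P ∈ E} φ^γ(P) = Σ_η P^γ(η) Ψ(supp η ∪ X ∈ E)`
  have hsum : ∑ P : Finset (Plaquette d L),
      (if P ∈ E then phiProb (1 - Real.exp (-(4 * β))) γ P else 0) =
      ∑ η : Plaquette d L → ZMod 2, htProb β γ η *
        eventProb (ZMod 2) (Real.tanh (2 * β)) 1 {X | supp η ∪ X ∈ E} := by
    rw [← Finset.sum_filter]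
    simp_rw [← sum_htProb_bernoulli_eq_phiProb hβ hγ]
    rw [Finset.sum_comm]
    refine Finset.sum_congr rfl fun η _ => ?_
    rw [← Finset.mul_sum, sum_eventProb_union_eq]
  rw [hsum]
  calc eventProb (ZMod 2) (Real.tanh (2 * β)) 1 E
      = ∑ η : Plaquette d L → ZMod 2, htProb β γ η * eventProb (ZMod 2) (Real.tanh (2 * β)) 1 E := by
        rw [← Finset.sum_mul, sum_htProb_eq_one hβ hγ, one_mul]
    _ ≤ ∑ η : Plaquette d L → ZMod 2, htProb β γ η *
          eventProb (ZMod 2) (Real.tanh (2 * β)) 1 {X | supp η ∪ X ∈ E} := by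
        refine Finset.sum_le_sum fun η _ => mul_le_mul_of_nonneg_left ?_ (htProb_nonneg hβ.le γ η)
        refine eventProb_mono_set (ZMod 2) ht zero_le_one ?_
        intro X hX
        exact hE (Finset.subset_union_right : X ≤ supp η ∪ X) hX

/-- **Proposition 6.6, lower half, through the coupling** (`γ = 0`): `Ψ_{tanh 2β}(E) ≤ φ⁰_{1-e^{-4β}}(E)`
for increasing `E`, with `φ⁰` the plaquette random-cluster measure `PlaquetteRC.eventProb (ZMod 2) p 2`
(the tree's FK route gives the same inequality as `PlaquetteRC.eventProb_sandwich`, since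
`p̂(1-e^{-4β}, 2) = tanh 2β`). [cite: ForsstromViklund2025currents, Prop. 6.6] -/
theorem bernoulli_le_rc_zero {β : ℝ} (hβ : 0 < β) (E : Set (Finset (Plaquette d L)))
    [DecidablePred (· ∈ E)] (hE : IsUpperSet E) :
    eventProb (ZMod 2) (Real.tanh (2 * β)) 1 E ≤ eventProb (ZMod 2) (1 - Real.exp (-(4 * β))) 2 E := by
  classical
  have h := bernoulli_le_sum_phiProb hβ ⟨0, bd₂_zero⟩ E hE
  have hval : ∑ P : Finset (Plaquette d L), (if P ∈ E then phiProb (1 - Real.exp (-(4 * β))) 0 P else 0) =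
      eventProb (ZMod 2) (1 - Real.exp (-(4 * β))) 2 E := by
    unfold eventProb
    refine Finset.sum_congr rfl fun P _ => ?_
    split_ifs
    · exact phiProb_zero _ P
    · rfl
  rw [hval] at h
  exact h

end IsingGaugeCurrents

end Literature.MathematicalPhysics.QuantumFieldTheory
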